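import Summits.RiemannHypothesis.RiemannHypothesis.Theorems.LiDirichletEchoImContour
import Summits.RiemannHypothesis.RiemannHypothesis.Theorems.LiDirichletEchoCharWindowConj
import HarnessLib

/-!
# RiemannHypothesis / LiDirichletEcho — complex companion, part 6: the conjugation split of the COMPLEX both-signs trace
# (RH-FREE, GRH-FREE)

RH-FREE · GRH-FREE [rh-li-eng g5].  Towards `LiTheory.LiZeroWindowEchoDirichletComplex`.  For `χ ≠ 1` and `0 ≤ T₁ ≤ T₂`:

  `charZeroTraceWindowC χ n T₁ T₂ = charUpperTraceWindowC χ n T₁ T₂ + conj (charUpperTraceWindowC χ⁻¹ n T₁ T₂)`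

— the complex form of the route's support `CharWindowConj` (`Theorems/LiDirichletEchoCharWindowConj.lean`): the zeros of
`L(s, χ)` with `Im ρ < 0` are the conjugates of the zeros of `L(s, χ⁻¹)` with `Im ρ > 0`, with the same multiplicity
(`WindowConjChar.bijOn_conj`, `WindowConjChar.term_conj`), and the real zeros (if any) cancel in the window.  In particular
`Im W_C(χ) = Im U_C(χ) − Im U_C(χ⁻¹)`.  Nothing here bears on the truth of RH or GRH.
-/

noncomputable section

-- D-0017: `Summit.<S>.<S>.…` is the designed namespace of a single-problem summit.
set_option linter.dupNamespace false

open Complex Set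
open scoped ComplexConjugate

namespace Summit.RiemannHypothesis.RiemannHypothesis.Theorems.LiTheory

open Literature.NumberTheory.LFunctions Literature.NumberTheory.LFunctions.ExplicitPsiChar

namespace ComplexSplitChar

open WindowConjChar

variable {q : ℕ} [NeZero q] {χ : DirichletCharacter ℂ q}

/-- **The complex both-signs trace splits**: for `χ ≠ 1` and `T ≥ 0`,
`Z_C(χ, T) = U_C(χ, T) + conj U_C(χ⁻¹, T) + Σ_{real zeros} m_χ(ρ)(1 − 1/ρ)ⁿ` (the last sum is independent of `T`). -/
theorem charZeroTraceC_split (hχ : χ ≠ 1) (n : ℕ) {T : ℝ} (hT : 0 ≤ T) :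
    charZeroTraceC χ n T = charUpperZeroTraceC χ n T + conj (charUpperZeroTraceC χ⁻¹ n T)
      + ∑ᶠ ρ ∈ {ρ : ℂ | ρ ∈ charNontrivialZeros χ ∧ ρ.im = 0}, term χ n ρ := by
  -- as `WindowConjChar.charZeroTrace_split`, without taking real parts
  have hχ' : χ⁻¹ ≠ 1 := inv_ne_one.mpr hχ
  set S : Set ℂ := lfunctionZeroBox χ T with hS
  set Sp : Set ℂ := S ∩ {ρ : ℂ | 0 < ρ.im} with hSp
  set Sm : Set ℂ := S ∩ {ρ : ℂ | ρ.im < 0} with hSm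
  set S0 : Set ℂ := {ρ : ℂ | ρ ∈ charNontrivialZeros χ ∧ ρ.im = 0} with hS0
  set Sp' : Set ℂ := lfunctionZeroBox χ⁻¹ T ∩ {ρ : ℂ | 0 < ρ.im} with hSp'
  have hSf : S.Finite := lfunctionZeroBox_finite hχ T
  have hSpf : Sp.Finite := hSf.subset inter_subset_left
  have hSmf : Sm.Finite := hSf.subset inter_subset_left
  have hS0S : S0 ⊆ S := by
    rintro ρ ⟨hρ, him⟩
    obtain ⟨hL, h0, h1⟩ := mem_charNontrivialZeros.1 hρ
    exact mem_lfunctionZeroBox.2 ⟨hL, h0, h1, by rw [him, abs_zero]; exact hT⟩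
  have hS0f : S0.Finite := hSf.subset hS0S
  have hunion : S = (Sp ∪ Sm) ∪ S0 := by
    ext ρ
    simp only [hSp, hSm, hS0, mem_union, mem_inter_iff, mem_setOf_eq]
    constructor
    · intro hρ
      rcases lt_trichotomy 0 ρ.im with h | h | h
      · exact Or.inl (Or.inl ⟨hρ, h⟩)
      · obtain ⟨hL, h0, h1, -⟩ := mem_lfunctionZeroBox.1 hρ
        exact Or.inr ⟨mem_charNontrivialZeros.2 ⟨hL, h0, h1⟩, h.symm⟩
      · exact Or.inl (Or.inr ⟨hρ, h⟩)
    · rintro ((⟨hρ, -⟩ | ⟨hρ, -⟩) | h0)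
      · exact hρ
      · exact hρ
      · exact hS0S h0
  have hd1 : Disjoint Sp Sm := by
    rw [Set.disjoint_left]
    rintro ρ ⟨-, h1⟩ ⟨-, h2⟩
    have h1' : 0 < ρ.im := h1
    have h2' : ρ.im < 0 := h2
    exact lt_asymm h1' h2'
  have hd2 : Disjoint (Sp ∪ Sm) S0 := by
    rw [Set.disjoint_left]
    rintro ρ (⟨-, h1⟩ | ⟨-, h1⟩) ⟨-, h2⟩
    · have h1' : 0 < ρ.im := h1
      exact h1'.ne' h2
    · have h1' : ρ.im < 0 := h1
      exact h1'.ne h2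
  have hminus : ∑ᶠ ρ ∈ Sm, term χ n ρ = conj (∑ᶠ ρ ∈ Sp', term χ⁻¹ n ρ) := by
    have hSp'f : Sp'.Finite := (lfunctionZeroBox_finite hχ' T).subset inter_subset_left
    rw [finsum_mem_eq_of_bijOn (fun ρ : ℂ ↦ conj ρ) (bijOn_conj hχ T) (fun ρ _ ↦ ?_)]
    · exact (AddMonoidHom.map_finsum_mem (fun ρ ↦ term χ⁻¹ n ρ) (starRingEnd ℂ).toAddMonoidHom hSp'f).symm
    · show term χ n ρ = conj (term χ⁻¹ n (conj ρ))
      have := term_conj hχ n (conj ρ)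
      rw [Complex.conj_conj] at this
      exact this
  unfold charZeroTraceC charUpperZeroTraceC
  change ∑ᶠ ρ ∈ S, term χ n ρ = (∑ᶠ ρ ∈ Sp, term χ n ρ) + conj (∑ᶠ ρ ∈ Sp', term χ⁻¹ n ρ)
    + ∑ᶠ ρ ∈ S0, term χ n ρ
  rw [hunion, finsum_mem_union hd2 (hSpf.union hSmf) hS0f, finsum_mem_union hd1 hSpf hSmf, hminus]

end ComplexSplitChar

open ComplexSplitChar in
/-- **The conjugation split of the complex windowed trace** (RH-FREE, GRH-FREE): for `χ ≠ 1` and `0 ≤ T₁ ≤ T₂`,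
`charZeroTraceWindowC χ n T₁ T₂ = charUpperTraceWindowC χ n T₁ T₂ + conj (charUpperTraceWindowC χ⁻¹ n T₁ T₂)`. -/
theorem charZeroTraceWindowC_split {q : ℕ} [NeZero q] (χ : DirichletCharacter ℂ q) (hχ : χ ≠ 1) (n : ℕ) {T₁ T₂ : ℝ}
    (hT₁ : 0 ≤ T₁) (hT : T₁ ≤ T₂) :
    charZeroTraceWindowC χ n T₁ T₂ =
      charUpperTraceWindowC χ n T₁ T₂ + conj (charUpperTraceWindowC χ⁻¹ n T₁ T₂) := by
  unfold charZeroTraceWindowC charUpperTraceWindowC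
  rw [charZeroTraceC_split hχ n hT₁, charZeroTraceC_split hχ n (hT₁.trans hT), map_sub]
  ring

/-- In particular `Im W_C(χ) = Im U_C(χ) − Im U_C(χ⁻¹)` on the window. -/
theorem charZeroTraceWindowC_im {q : ℕ} [NeZero q] (χ : DirichletCharacter ℂ q) (hχ : χ ≠ 1) (n : ℕ) {T₁ T₂ : ℝ}
    (hT₁ : 0 ≤ T₁) (hT : T₁ ≤ T₂) :
    (charZeroTraceWindowC χ n T₁ T₂).im =
      (charUpperTraceWindowC χ n T₁ T₂).im - (charUpperTraceWindowC χ⁻¹ n T₁ T₂).im := by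
  rw [charZeroTraceWindowC_split χ hχ n hT₁ hT, Complex.add_im, Complex.conj_im]
  ring

end Summit.RiemannHypothesis.RiemannHypothesis.Theorems.LiTheory

end
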